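import Summits.Ventures.PercRepro.S1TriangleKernelSixRestrict
import Summits.Ventures.PercRepro.S1TriangleKernelSixCaseACount
import Summits.Ventures.PercRepro.S1TriangleKernelSixCaseB

/-!
# PercRepro — THE TRIANGLE KERNEL AT NULLITY `6`: `s₃ ≤ 10` under (C1), (C2) and (C3) (p8, gen 24; a feeder for S4 —
the rows `≤ 36` of the `q = 7` window)

The refined bootstrap (S1TriangleCountBootEight) gives `s₃ ≤ triBound8 6 = 11` at nullity `6`; the value `11` is never
attained — the truth is `10` (`M(K₅)`). At the point `x` on the fewest triangles (`m := t_x`): `s₃ ≤ m + 8` (the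
kernel at nullity `5` on `M ＼ {x}`) and `m + 2m² ≤ 3 s₃` force, for `s₃ = 11`, `m = 3` and `7 ≤ |U| ≤ 11` on
`U := ⋃ triangles`; the restriction step (`M ↾ U` has the same triangles, so its nullity is `6`; `r(U) ≥ 4` by (C2),
`r(U) ≥ 5` once `|U| ≥ 11` by (C3)) gives `|U| = 10` or `|U| = 11` with `r(U) = 5`. Write `C₁, C₂, C₃` for the
triangles through `x`, `St` for the star (`7` points, rank `≤ 4`), `Q = U ∖ St` (`3` or `4` points), `S₂` for the `8`
triangles avoiding `x`; every member of `S₂` has a point in `Q` (no transversal, S1TriangleKernelSixLemmas).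
* `|Q| = 3`: every `q ∈ Q` has a triangle meeting `Q` only in `q` (three triangles through `q` meet `Q ∖ {q}`, two
  points, only in distinct points), hence lies in a plane `P_ij = cl(Cᵢ ∪ Cⱼ)`; no `q` lies in two planes, no plane
  holds two points of `Q` ((C2)); so a triangle `{a, q, q'}` with one star point is impossible (it lies in the plane
  of `q` or of `q'`, or both planes avoid `a`'s triangle and coincide), and through each `q` pass at most `2`
  triangles meeting `Q` only in `q` (they lie in the plane of `q` and use distinct points of `Cᵢ ∖ {x}`): `S₂` has
  at most `2·3 + 1` members (the `+ 1` for `Q` itself), against `8`.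
* `|Q| = 4`, `r(U) = 5`: some `q ∈ U` lies off `cl(St)` (rank `≤ 4`); every triangle through such a `q` has a second
  point off `cl(St)`, so `U ∖ cl(St)` has `≥ 4` points and equals `Q`. Then no triangle avoiding `x` has two star
  points (its third point would be in `cl(St)`), and the `6` star points off `x`, each on `≥ 2` triangles avoiding
  `x`, give `≥ 12` distinct members of `S₂`, against `8`.
Hence **`s₃ ≤ 10` at nullity `6`** (`kernelSix_ncard_triangles_le_ten`). Axioms: standard.
-/

open scoped Matroid

namespace PercRepro

namespace S1

open Set

variable {α : Type}

/-- **THE TRIANGLE KERNEL AT NULLITY `6`.** If `|E| = r(E) + 6`, every rank-`2` set has at most `3` elements (C1), every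
rank-`≤ 3` set at most `6` (C2) and every rank-`≤ 4` set at most `10` (C3), then `#(triangles M) ≤ 10`. -/
theorem kernelSix_ncard_triangles_le_ten (M : Matroid α) [M.Finite]
    (hC1 : ∀ L ⊆ M.E, M.eRk L = 2 → L.ncard ≤ 3)
    (hC2 : ∀ X ⊆ M.E, M.eRk X ≤ 3 → X.ncard ≤ 6)
    (hC3 : ∀ X ⊆ M.E, M.eRk X ≤ 4 → X.ncard ≤ 10)
    (hd : M.E.encard = M.eRank + 6) : (ThmN.triangles M).ncard ≤ 10 := by
  classical
  set S := ThmN.triangles M with hS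
  have hSfin : S.Finite :=
    M.ground_finite.finite_subsets.subset (fun C hC => hC.1.subset_ground)
  by_cases hSe : S = ∅
  · rw [hSe, ncard_empty]; exact Nat.zero_le _
  -- the point on the fewest triangles
  have hUE : ⋃₀ S ⊆ M.E := by
    intro z hz
    obtain ⟨C, hC, hzC⟩ := Set.mem_sUnion.1 hz
    exact hC.1.subset_ground hzC
  have hUfin : (⋃₀ S).Finite := M.ground_finite.subset hUE
  set Uf : Finset α := hUfin.toFinset with hUf
  have hmemU : ∀ x, x ∈ Uf ↔ x ∈ ⋃₀ S := fun x => Set.Finite.mem_toFinset hUfin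
  have hUne : Uf.Nonempty := by
    obtain ⟨C₀, hC₀⟩ := nonempty_iff_ne_empty.2 hSe
    obtain ⟨e, heC₀⟩ := hC₀.1.nonempty
    exact ⟨e, (hmemU e).2 (Set.mem_sUnion.2 ⟨C₀, hC₀, heC₀⟩)⟩
  obtain ⟨x, hxU, hxmin⟩ := Finset.exists_min_image Uf (fun y => (ThmN.trianglesThrough M y).ncard) hUne
  have hxU' : x ∈ ⋃₀ S := (hmemU x).1 hxU
  obtain ⟨C₀, hC₀, hxC₀⟩ := Set.mem_sUnion.1 hxU'
  set m := (ThmN.trianglesThrough M x).ncard with hm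
  have hmin : ∀ y ∈ ⋃₀ ThmN.triangles M, m ≤ (ThmN.trianglesThrough M y).ncard :=
    fun y hy => hxmin y ((hmemU y).2 hy)
  have heE : x ∈ M.E := hC₀.1.subset_ground hxC₀
  have hne : ¬ M.IsColoop x := hC₀.1.not_isColoop_of_mem hxC₀
  have hx : M.IsNonloop x := by
    refine _root_.Matroid.isNonloop_of_not_isLoop heE ?_
    intro hloop
    have hC₀e : C₀ = {x} := hloop.eq_of_isCircuit_mem hC₀.1 hxC₀
    have := hC₀.2
    rw [hC₀e, ncard_singleton] at this
    omega
  -- the nullity of `M ＼ {x}` is `5`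
  have hν : M✶.eRank = (6 : ℕ∞) := by
    have h := _root_.Matroid.eRank_add_eRank_dual M
    rw [hd] at h
    exact WithTop.add_left_cancel (PercRepro.Matroid.eRank_ne_top_of_finite M) h
  have hdel := PercRepro.Matroid.dual_eRank_delete_singleton_add_one heE hne
  rw [hν] at hdel
  have hfin' : (M ＼ {x})✶.eRank ≠ ⊤ := by
    intro h
    rw [h] at hdel
    exact absurd hdel (by simp)
  obtain ⟨d', hd'⟩ := ENat.ne_top_iff_exists.1 hfin'
  have hdd' : d' + 1 = 6 := by
    rw [← hd'] at hdel
    exact_mod_cast hdel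
  have hd'5 : d' = 5 := by omega
  have hd'enc : (M ＼ {x}).E.encard = (M ＼ {x}).eRank + d' := by
    have h := _root_.Matroid.eRank_add_eRank_dual (M ＼ {x})
    rw [← hd'] at h
    exact h.symm
  have hC1' : ∀ L ⊆ (M ＼ {x}).E, (M ＼ {x}).eRk L = 2 → L.ncard ≤ 3 := by
    intro L hL hr
    rw [_root_.Matroid.delete_ground] at hL
    rw [delete_singleton_eRk_eq hL] at hr
    exact hC1 L (hL.trans sdiff_subset) hr
  have hC2' : ∀ X ⊆ (M ＼ {x}).E, (M ＼ {x}).eRk X ≤ 3 → X.ncard ≤ 6 := by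
    intro X hX hr
    rw [_root_.Matroid.delete_ground] at hX
    rw [delete_singleton_eRk_eq hX] at hr
    exact hC2 X (hX.trans sdiff_subset) hr
  have hC3' : ∀ X ⊆ (M ＼ {x}).E, (M ＼ {x}).eRk X ≤ 4 → X.ncard ≤ 10 := by
    intro X hX hr
    rw [_root_.Matroid.delete_ground] at hX
    rw [delete_singleton_eRk_eq hX] at hr
    exact hC3 X (hX.trans sdiff_subset) hr
  -- (a) `s₃ ≤ m + 8`
  set S₁ := ThmN.trianglesThrough M x with hS₁
  set S₂ := {C | M.IsCircuit C ∧ C.ncard = 3 ∧ x ∉ C} with hS₂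
  have hsplit : S ⊆ S₁ ∪ S₂ := by
    intro C hC
    by_cases h : x ∈ C
    · exact Or.inl ⟨hC.1, hC.2, h⟩
    · exact Or.inr ⟨hC.1, hC.2, h⟩
  have hS₁fin : S₁.Finite := hSfin.subset (fun C hC => ⟨hC.1, hC.2.1⟩)
  have hS₂fin : S₂.Finite := hSfin.subset (fun C hC => ⟨hC.1, hC.2.1⟩)
  have h3 : S.ncard ≤ S₁.ncard + S₂.ncard :=
    (ncard_le_ncard hsplit (hS₁fin.union hS₂fin)).trans (ncard_union_le _ _)
  have hsub : S₂ ⊆ ThmN.triangles (M ＼ {x}) := by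
    intro C hC
    exact ⟨_root_.Matroid.delete_isCircuit_iff.2 ⟨hC.1, disjoint_singleton_right.2 hC.2.2⟩, hC.2.1⟩
  have hS₂ : S₂.ncard ≤ 8 := by
    have h := (ncard_le_ncard hsub
      ((M ＼ {x}).ground_finite.finite_subsets.subset (fun C hC => hC.1.subset_ground))).trans
      (ncard_triangles_le_triBound8 (M ＼ {x}) hC1' hC2' hC3' hd'enc)
    rw [hd'5, triBound8_val_5] at h
    exact h
  have ha : S.ncard ≤ m + 8 := by omega
  -- (b) the star and the double count
  have hstar : 1 + 2 * m ≤ (⋃₀ S).ncard := one_add_two_mul_ncard_trianglesThrough_le M hC1 hx hxU'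
  have hdc : (⋃₀ S).ncard * m ≤ 3 * S.ncard := ncard_sUnion_mul_le_three_mul_ncard_triangles M hmin
  have hb : m + 2 * m * m ≤ 3 * S.ncard := by
    have h1 : (1 + 2 * m) * m ≤ (⋃₀ S).ncard * m := Nat.mul_le_mul_right m hstar
    have h2 : (1 + 2 * m) * m = m + 2 * m * m := by ring
    rw [h2] at h1
    exact h1.trans hdc
  -- the bootstrap's own bound `s₃ ≤ 11`
  have hup : S.ncard ≤ 11 := by
    have h := ncard_triangles_le_triBound8 M hC1 hC2 hC3 hd
    rw [triBound8_val_6] at h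
    exact h
  -- (c) if `s₃ ≥ 11` then `s₃ = 11`, `m = 3`, `7 ≤ |U| ≤ 11`
  by_contra hcon
  have hs11 : S.ncard = 11 := by omega
  have hm3 : m = 3 := by
    have hm_ge : 3 ≤ m := by omega
    have hm_le : m ≤ 3 := by nlinarith
    omega
  have hU11 : (⋃₀ S).ncard ≤ 11 := by
    rw [hm3, hs11] at hdc
    omega
  have hU7 : 7 ≤ (⋃₀ S).ncard := by
    rw [hm3] at hstar
    omega
  -- (d) the restriction step: `|U| = 10`, or `|U| = 11` with `r(U) = 5`
  have hUcase := ncard_sUnion_triangles_of_eleven M hC1 hC2 hC3 hs11 hU7 hU11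
  -- every point of `U` lies on at least `3` triangles
  have hmin3 : ∀ y ∈ ⋃₀ S, 3 ≤ (ThmN.trianglesThrough M y).ncard := by
    intro y hy
    have := hmin y hy
    omega
  -- (e) the star of `x`: `s = {C₁, C₂, C₃}`, `St` with `7` points and rank `≤ 4`
  set s : Finset (Set α) := hS₁fin.toFinset with hsdef
  have hs : ∀ C ∈ s, C ∈ ThmN.trianglesThrough M x :=
    fun C hC => (Set.Finite.mem_toFinset hS₁fin).1 hC
  have hs' : ∀ C, C ∈ ThmN.trianglesThrough M x → C ∈ s :=
    fun C hC => (Set.Finite.mem_toFinset hS₁fin).2 hC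
  have hscard : s.card = 3 := by
    rw [hsdef, ← Set.ncard_eq_toFinset_card _ hS₁fin]
    exact hm3
  obtain ⟨hstar_rk, hstar_card⟩ := ThmN.eRk_le_and_ncard_eq_of_triangles M hC1 hx s hs
  rw [hscard] at hstar_card hstar_rk
  obtain ⟨Ci, Cj, Ck, hij, hik, hjk, hs_eq⟩ := Finset.card_eq_three.1 hscard
  have hCi : Ci ∈ ThmN.trianglesThrough M x := hs Ci (by rw [hs_eq]; simp)
  have hCj : Cj ∈ ThmN.trianglesThrough M x := hs Cj (by rw [hs_eq]; simp)
  have hCk : Ck ∈ ThmN.trianglesThrough M x := hs Ck (by rw [hs_eq]; simp)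
  have hmem3 : ∀ C, C ∈ ThmN.trianglesThrough M x → C = Ci ∨ C = Cj ∨ C = Ck := by
    intro C hC
    have := hs' C hC
    rw [hs_eq] at this
    simpa using this
  set St := ({x} ∪ (Ci ∪ Cj ∪ Ck) : Set α) with hSt
  have hSteq : ({x} ∪ ⋃ C ∈ s, C) = St := by
    ext z
    constructor
    · intro hz
      rcases hz with hz | hz
      · exact Or.inl hz
      · obtain ⟨C, hC, hzC⟩ := Set.mem_iUnion₂.1 hz
        rw [hs_eq] at hC
        simp only [Finset.mem_insert, Finset.mem_singleton] at hC
        rcases hC with rfl | rfl | rfl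
        · exact Or.inr (Or.inl (Or.inl hzC))
        · exact Or.inr (Or.inl (Or.inr hzC))
        · exact Or.inr (Or.inr hzC)
    · intro hz
      rcases hz with hz | hz
      · exact Or.inl hz
      · refine Or.inr ?_
        rcases hz with (hz | hz) | hz
        · exact Set.mem_iUnion₂.2 ⟨Ci, by rw [hs_eq]; simp, hz⟩
        · exact Set.mem_iUnion₂.2 ⟨Cj, by rw [hs_eq]; simp, hz⟩
        · exact Set.mem_iUnion₂.2 ⟨Ck, by rw [hs_eq]; simp, hz⟩
  rw [hSteq] at hstar_card hstar_rk
  have hStU : St ⊆ ⋃₀ S := by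
    intro z hz
    rcases hz with hz | hz
    · rw [Set.mem_singleton_iff.1 hz]; exact hxU'
    · rcases hz with (hz | hz) | hz
      · exact Set.mem_sUnion.2 ⟨Ci, ⟨hCi.1, hCi.2.1⟩, hz⟩
      · exact Set.mem_sUnion.2 ⟨Cj, ⟨hCj.1, hCj.2.1⟩, hz⟩
      · exact Set.mem_sUnion.2 ⟨Ck, ⟨hCk.1, hCk.2.1⟩, hz⟩
  -- the two cases
  have hS₂card : S₂.ncard = 8 := by
    have hS₁card : S₁.ncard = 3 := hm3
    have hS₁S₂ : Disjoint S₁ S₂ := by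
      rw [Set.disjoint_left]
      intro C hC hC'
      exact hC'.2.2 hC.2.2
    have hunion : S₁ ∪ S₂ = S := by
      ext C
      constructor
      · rintro (hC | hC)
        · exact ⟨hC.1, hC.2.1⟩
        · exact ⟨hC.1, hC.2.1⟩
      · exact fun hC => hsplit hC
    have := Set.ncard_union_eq hS₁S₂ hS₁fin hS₂fin
    rw [hunion, hs11, hS₁card] at this
    omega
  rcases hUcase with hU10 | ⟨hU11', hr5⟩
  · -- CASE A: `|U| = 10`, `|Q| = 3`
    have hQ3 : ((⋃₀ S) \ ({x} ∪ (Ci ∪ Cj ∪ Ck))).ncard = 3 := by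
      rw [Set.ncard_sdiff' hStU hUfin, hU10, hstar_card]
    exact false_of_ncard_sdiff_star_eq_three M hC1 hC2 hx hCi hCj hCk hij hik hjk hmem3 hmin3 hS₂card hQ3
  · -- CASE B: `|U| = 11`, `|Q| = 4`, `r(U) = 5`
    have hQ4 : ((⋃₀ S) \ ({x} ∪ (Ci ∪ Cj ∪ Ck))).ncard = 4 := by
      rw [Set.ncard_sdiff' hStU hUfin, hU11', hstar_card]
    exact false_of_ncard_sdiff_star_eq_four M hC1 hC2 hx hCi hCj hCk hij hik hjk hmem3 hmin3 hS₂card hQ4 hr5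

end S1

end PercRepro
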